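import Mathlib
import Summits.Ventures.PercRepro2.Defs
import Summits.Ventures.PercRepro2.Independence
import Summits.Ventures.PercRepro2.Harris
import Summits.Ventures.PercRepro2.Graph
import Summits.Ventures.PercRepro2.Exploration
import Summits.Ventures.PercRepro2.Events
import Summits.Ventures.PercRepro2.FourFunctions
import Summits.Ventures.PercRepro2.Induced
import Summits.Ventures.PercRepro2.Frontier
import Summits.Ventures.PercRepro2.ObsIndependence
import Summits.Ventures.PercRepro2.BHK
import Summits.Ventures.PercRepro2.BHKEvents
import Summits.Ventures.PercRepro2.YBridge
import Summits.Ventures.PercRepro2.ZMeanBound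

/-!
# Events on the cluster event `{C(a₃) = W}` (blind cell PercRepro2, mine-1 g7; tools for
`Xexact ≤ Xhat`)

On `{C(v) = ↑W}`: a vertex `x` is connected to `v` iff `x ∈ W` (`cl_inter_conn_self`); a connection
between `u ∉ W` and `w ∈ W` is impossible (`cl_inter_conn_eq_empty`); a connection between two
vertices outside `W` is the residual connection (`cl_inter_conn_eq_del`, typer-1's
`clusterEvent_inter_connEvent`); hence the complement of a connection event restricts likewise
(`cl_inter_compl_conn_eq_del`).  All are `Set` identities; the probabilistic consequences follow
from the domain Markov property `prob_clusterEvent_inter_eq_mul`.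
-/

namespace Summit.Ventures.PercRepro2

section DelQ

variable {V : Type*} {E : Type*} [Fintype V] [DecidableEq V]

/-- `{a₁ ↮ a₂ in G ∖ W}`: the residual disconnection event `Q_W`. -/
def delQ (ends : E → Sym2 V) (W : Finset V) (a₁ a₂ : V) : Set (Config E) :=
  (connDelEvent ends W a₁ a₂)ᶜ

end DelQ

section ClusterEvents

variable {V : Type*} {E : Type*} [Fintype V] [DecidableEq V]

omit [Fintype V] [DecidableEq V] in
/-- On `{C(v) = S}`, `Conn v x ↔ x ∈ S`. -/
lemma conn_iff_mem_of_cluster_eq {ends : E → Sym2 V} {ω : Config E} {v : V} {S : Set V}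
    (hS : cluster ends ω v = S) (x : V) : Conn ends ω v x ↔ x ∈ S := by
  rw [← hS]; rfl

omit [Fintype V] [DecidableEq V] in
/-- `{C(v) = S} ∩ {v ↔ x} = {C(v) = S}` when `x ∈ S`. -/
lemma cl_inter_conn_self_of_mem (ends : E → Sym2 V) (v : V) (S : Set V) {x : V} (hx : x ∈ S) :
    clusterEvent ends v S ∩ connEvent ends v x = clusterEvent ends v S := by
  ext ω
  simp only [Set.mem_inter_iff, mem_clusterEvent, mem_connEvent]
  constructor
  · exact fun h => h.1
  · intro h; exact ⟨h, (conn_iff_mem_of_cluster_eq h x).2 hx⟩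

omit [Fintype V] [DecidableEq V] in
/-- `{C(v) = S} ∩ {v ↔ x} = ∅` when `x ∉ S`. -/
lemma cl_inter_conn_self_of_notMem (ends : E → Sym2 V) (v : V) (S : Set V) {x : V}
    (hx : x ∉ S) : clusterEvent ends v S ∩ connEvent ends v x = ∅ := by
  ext ω
  simp only [Set.mem_inter_iff, mem_clusterEvent, mem_connEvent, Set.mem_empty_iff_false,
    iff_false, not_and]
  intro h hc
  exact hx ((conn_iff_mem_of_cluster_eq h x).1 hc)

omit [Fintype V] [DecidableEq V] in
/-- `{C(v) = S} ∩ {u ↔ w} = ∅` when `u ∉ S` and `w ∈ S`. -/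
lemma cl_inter_conn_eq_empty (ends : E → Sym2 V) (v : V) (S : Set V) {u w : V} (hu : u ∉ S)
    (hw : w ∈ S) : clusterEvent ends v S ∩ connEvent ends u w = ∅ := by
  ext ω
  simp only [Set.mem_inter_iff, mem_clusterEvent, mem_connEvent, Set.mem_empty_iff_false,
    iff_false, not_and]
  intro h hc
  have hvw : Conn ends ω v w := (conn_iff_mem_of_cluster_eq h w).2 hw
  exact hu ((conn_iff_mem_of_cluster_eq h u).1 (conn_trans hvw (conn_symm hc)))

omit [Fintype V] [DecidableEq V] in
/-- The mirror: `{C(v) = S} ∩ {u ↔ w} = ∅` when `u ∈ S` and `w ∉ S`. -/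
lemma cl_inter_conn_eq_empty' (ends : E → Sym2 V) (v : V) (S : Set V) {u w : V} (hu : u ∈ S)
    (hw : w ∉ S) : clusterEvent ends v S ∩ connEvent ends u w = ∅ := by
  ext ω
  simp only [Set.mem_inter_iff, mem_clusterEvent, mem_connEvent, Set.mem_empty_iff_false,
    iff_false, not_and]
  intro h hc
  have hvu : Conn ends ω v u := (conn_iff_mem_of_cluster_eq h u).2 hu
  exact hw ((conn_iff_mem_of_cluster_eq h w).1 (conn_trans hvu hc))

/-- On `{C(v) = ↑W}`, for `u ∉ W` the connection `{u ↔ w}` is the residual one. -/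
lemma cl_inter_conn_eq_del (ends : E → Sym2 V) (v : V) (W : Finset V) {u w : V} (hu : u ∉ W) :
    clusterEvent ends v (↑W : Set V) ∩ connEvent ends u w =
      clusterEvent ends v (↑W : Set V) ∩ connDelEvent ends W u w :=
  clusterEvent_inter_connEvent ends v (↑W : Set V) (by simpa using hu)

/-- On `{C(v) = ↑W}`, for `u ∉ W` the complement of `{u ↔ w}` is the complement of the residual
connection. -/
lemma cl_inter_compl_conn_eq_del (ends : E → Sym2 V) (v : V) (W : Finset V) {u w : V}
    (hu : u ∉ W) :
    clusterEvent ends v (↑W : Set V) ∩ (connEvent ends u w)ᶜ =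
      clusterEvent ends v (↑W : Set V) ∩ (connDelEvent ends W u w)ᶜ := by
  have h := cl_inter_conn_eq_del ends v W (w := w) hu
  ext ω
  constructor
  · rintro ⟨hc, hn⟩
    refine ⟨hc, fun hd => hn ?_⟩
    have : ω ∈ clusterEvent ends v (↑W : Set V) ∩ connDelEvent ends W u w := ⟨hc, hd⟩
    rw [← h] at this
    exact this.2
  · rintro ⟨hc, hn⟩
    refine ⟨hc, fun hd => hn ?_⟩
    have : ω ∈ clusterEvent ends v (↑W : Set V) ∩ connEvent ends u w := ⟨hc, hd⟩
    rw [h] at this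
    exact this.2

end ClusterEvents

end Summit.Ventures.PercRepro2

namespace Summit.Ventures.PercRepro2

/-! ## Pointwise dictionary on `{C(a₃) = ↑W}` -/

section Pointwise

variable {V : Type*} {E : Type*} [Fintype V] [DecidableEq V]

/-- On `{C(a₃) = ↑W}`, for `u ∉ W`: `u ↔ w` iff the residual connection holds. -/
lemma conn_iff_del_of_cluster_eq {ends : E → Sym2 V} {ω : Config E} {a₃ : V} {W : Finset V}
    (hS : cluster ends ω a₃ = ↑W) {u w : V} (hu : u ∉ W) :
    Conn ends ω u w ↔ ω ∈ connDelEvent ends W u w := by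
  rw [mem_connDelEvent]
  exact (conn_restrict_iff_of_cluster_eq hS (by simpa using hu)).symm

omit [Fintype V] [DecidableEq V] in
/-- On `{C(a₃) = S}`: `a₃ ↔ x` iff `x ∈ S`. -/
lemma conn_a3_iff_of_cluster_eq {ends : E → Sym2 V} {ω : Config E} {a₃ : V} {S : Set V}
    (hS : cluster ends ω a₃ = S) (x : V) : Conn ends ω a₃ x ↔ x ∈ S :=
  conn_iff_mem_of_cluster_eq hS x

omit [Fintype V] [DecidableEq V] in
/-- On `{C(a₃) = S}`, for `u ∉ S`, `w ∈ S`: `u ↔ w` is false. -/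
lemma not_conn_of_cluster_eq {ends : E → Sym2 V} {ω : Config E} {a₃ : V} {S : Set V}
    (hS : cluster ends ω a₃ = S) {u w : V} (hu : u ∉ S) (hw : w ∈ S) : ¬ Conn ends ω u w := by
  intro hc
  have hvw : Conn ends ω a₃ w := (conn_iff_mem_of_cluster_eq hS w).2 hw
  exact hu ((conn_iff_mem_of_cluster_eq hS u).1 (conn_trans hvw (conn_symm hc)))

end Pointwise

end Summit.Ventures.PercRepro2

namespace Summit.Ventures.PercRepro2

/-! ## The PD-type and T-type worlds on `{C(a₃) = ↑W}` -/

section Worlds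

variable {V : Type*} {E : Type*} [Fintype V] [DecidableEq V]

omit [Fintype V] [DecidableEq V] in
/-- Membership in `PDEvent`, unfolded. -/
lemma mem_PDEvent_iff {ends : E → Sym2 V} {a₁ a₂ a₃ : V} {ω : Config E} :
    ω ∈ PDEvent ends a₁ a₂ a₃ ↔
      ¬ Conn ends ω a₁ a₂ ∧ ¬ Conn ends ω a₃ a₁ ∧ ¬ Conn ends ω a₃ a₂ := by
  simp only [PDEvent, Dtilde, UnionCluster.inU, Set.mem_inter_iff, Set.mem_compl_iff,
    Set.mem_union, mem_connEvent, not_or]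

omit [Fintype V] [DecidableEq V] in
/-- Membership in `TEvent`, unfolded. -/
lemma mem_TEvent_iff {ends : E → Sym2 V} {a₁ a₂ a₃ : V} {ω : Config E} :
    ω ∈ TEvent ends a₁ a₂ a₃ ↔ ¬ Conn ends ω a₂ a₁ ∧ Conn ends ω a₂ a₃ := by
  simp only [TEvent, Set.mem_inter_iff, Set.mem_compl_iff, mem_connEvent]

/-- **PD-type cluster, generic joint**: on `{C(a₃) = ↑W}` with `a₁, a₂, x, y ∉ W`,
`PD ∩ {x ↔ u} ∩ {y ↔ w}` is the residual event `{a₁ ↮ a₂, x ↔ u, y ↔ w}` in `G ∖ W`. -/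
lemma cl_pd_joint (ends : E → Sym2 V) (W : Finset V) (a₁ a₂ a₃ x u y w : V) (h1 : a₁ ∉ W)
    (h2 : a₂ ∉ W) (hx : x ∉ W) (hy : y ∉ W) :
    clusterEvent ends a₃ (↑W : Set V) ∩
        (PDEvent ends a₁ a₂ a₃ ∩ connEvent ends x u ∩ connEvent ends y w) =
      clusterEvent ends a₃ (↑W : Set V) ∩
        {ω | restrict (touches ends ↑W)ᶜ ω ∈
          (connEvent ends a₁ a₂)ᶜ ∩ connEvent ends x u ∩ connEvent ends y w} := by
  ext ω
  simp only [Set.mem_inter_iff, mem_clusterEvent, mem_PDEvent_iff, mem_connEvent,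
    Set.mem_setOf_eq, Set.mem_compl_iff]
  constructor
  · rintro ⟨hS, ⟨⟨hQ, -, -⟩, hxu⟩, hyw⟩
    refine ⟨hS, ⟨?_, ?_⟩, ?_⟩
    · intro hc; exact hQ ((conn_restrict_iff_of_cluster_eq hS (by simpa using h1)).1 hc)
    · exact (conn_restrict_iff_of_cluster_eq hS (by simpa using hx)).2 hxu
    · exact (conn_restrict_iff_of_cluster_eq hS (by simpa using hy)).2 hyw
  · rintro ⟨hS, ⟨hQ, hxu⟩, hyw⟩
    refine ⟨hS, ⟨⟨?_, ?_, ?_⟩, ?_⟩, ?_⟩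
    · intro hc; exact hQ ((conn_restrict_iff_of_cluster_eq hS (by simpa using h1)).2 hc)
    · intro hc; exact h1 (by simpa using (conn_iff_mem_of_cluster_eq hS a₁).1 hc)
    · intro hc; exact h2 (by simpa using (conn_iff_mem_of_cluster_eq hS a₂).1 hc)
    · exact (conn_restrict_iff_of_cluster_eq hS (by simpa using hx)).1 hxu
    · exact (conn_restrict_iff_of_cluster_eq hS (by simpa using hy)).1 hyw

/-- **T-type cluster, generic joint**: on `{C(a₃) = ↑W}` with `x, y ∉ W`,
`{x ↔ u} ∩ {y ↔ w}` is the residual joint. -/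
lemma cl_joint (ends : E → Sym2 V) (W : Finset V) (a₃ x u y w : V) (hx : x ∉ W) (hy : y ∉ W) :
    clusterEvent ends a₃ (↑W : Set V) ∩ (connEvent ends x u ∩ connEvent ends y w) =
      clusterEvent ends a₃ (↑W : Set V) ∩
        {ω | restrict (touches ends ↑W)ᶜ ω ∈ connEvent ends x u ∩ connEvent ends y w} := by
  ext ω
  simp only [Set.mem_inter_iff, mem_clusterEvent, mem_connEvent, Set.mem_setOf_eq]
  constructor
  · rintro ⟨hS, hxu, hyw⟩
    exact ⟨hS, (conn_restrict_iff_of_cluster_eq hS (by simpa using hx)).2 hxu,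
      (conn_restrict_iff_of_cluster_eq hS (by simpa using hy)).2 hyw⟩
  · rintro ⟨hS, hxu, hyw⟩
    exact ⟨hS, (conn_restrict_iff_of_cluster_eq hS (by simpa using hx)).1 hxu,
      (conn_restrict_iff_of_cluster_eq hS (by simpa using hy)).1 hyw⟩

/-- On `{C(a₃) = ↑W}` with `x ∉ W`, `{x ↔ u}` is the residual connection. -/
lemma cl_single (ends : E → Sym2 V) (W : Finset V) (a₃ x u : V) (hx : x ∉ W) :
    clusterEvent ends a₃ (↑W : Set V) ∩ connEvent ends x u =
      clusterEvent ends a₃ (↑W : Set V) ∩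
        {ω | restrict (touches ends ↑W)ᶜ ω ∈ connEvent ends x u} :=
  cl_inter_conn_eq_del ends a₃ W hx

omit [Fintype V] [DecidableEq V] in
/-- On `{C(a₃) = S}` with `u ∈ S`: `{u ↔ w} = {C(a₃) = S}` if `w ∈ S`. -/
lemma cl_inter_conn_of_mem_mem (ends : E → Sym2 V) (a₃ : V) (S : Set V) {u w : V} (hu : u ∈ S)
    (hw : w ∈ S) : clusterEvent ends a₃ S ∩ connEvent ends u w = clusterEvent ends a₃ S := by
  ext ω
  simp only [Set.mem_inter_iff, mem_clusterEvent, mem_connEvent]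
  constructor
  · exact fun h => h.1
  · intro hS
    exact ⟨hS, conn_trans (conn_symm ((conn_iff_mem_of_cluster_eq hS u).2 hu))
      ((conn_iff_mem_of_cluster_eq hS w).2 hw)⟩

omit [Fintype V] [DecidableEq V] in
/-- On `{C(a₃) = S}` with `a₁, a₂ ∈ S`, `T = ∅`. -/
lemma cl_T_empty_of_mem_both (ends : E → Sym2 V) (S : Set V) (a₁ a₂ a₃ : V) (h1 : a₁ ∈ S)
    (h2 : a₂ ∈ S) : clusterEvent ends a₃ S ∩ TEvent ends a₁ a₂ a₃ = ∅ := by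
  ext ω
  simp only [Set.mem_inter_iff, mem_clusterEvent, mem_TEvent_iff, Set.mem_empty_iff_false,
    iff_false, not_and]
  intro hS hn _
  exact hn (conn_trans (conn_symm ((conn_iff_mem_of_cluster_eq hS a₂).2 h2))
    ((conn_iff_mem_of_cluster_eq hS a₁).2 h1))

omit [Fintype V] [DecidableEq V] in
/-- **PD-type cluster, T-world empty**: on `{C(a₃) = ↑W}` with `a₂ ∉ W`, `T = ∅`. -/
lemma cl_T_empty_of_notMem (ends : E → Sym2 V) (W : Finset V) (a₁ a₂ a₃ : V) (h2 : a₂ ∉ W) :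
    clusterEvent ends a₃ (↑W : Set V) ∩ TEvent ends a₁ a₂ a₃ = ∅ := by
  ext ω
  simp only [Set.mem_inter_iff, mem_clusterEvent, mem_TEvent_iff, Set.mem_empty_iff_false,
    iff_false, not_and]
  intro hS _ hc
  exact h2 (by simpa using (conn_iff_mem_of_cluster_eq hS a₂).1 (conn_symm hc))

omit [Fintype V] [DecidableEq V] in
/-- **T-type cluster**: on `{C(a₃) = ↑W}` with `a₂ ∈ W`, `a₁ ∉ W`, the event `T` holds. -/
lemma cl_subset_T (ends : E → Sym2 V) (W : Finset V) (a₁ a₂ a₃ : V) (h1 : a₁ ∉ W) (h2 : a₂ ∈ W) :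
    clusterEvent ends a₃ (↑W : Set V) ∩ TEvent ends a₁ a₂ a₃ = clusterEvent ends a₃ (↑W : Set V) := by
  ext ω
  simp only [Set.mem_inter_iff, mem_clusterEvent, mem_TEvent_iff]
  constructor
  · exact fun h => h.1
  · intro hS
    refine ⟨hS, ?_, ?_⟩
    · exact fun hc => not_conn_of_cluster_eq hS (by simpa using h1) (by simpa using h2) (conn_symm hc)
    · exact conn_symm ((conn_iff_mem_of_cluster_eq hS a₂).2 (by simpa using h2))

omit [Fintype V] [DecidableEq V] in
/-- **PD empty on a cluster containing a root**: on `{C(a₃) = ↑W}` with `a₂ ∈ W`, `PD = ∅`. -/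
lemma cl_PD_empty_of_mem₂ (ends : E → Sym2 V) (W : Finset V) (a₁ a₂ a₃ : V) (h2 : a₂ ∈ W) :
    clusterEvent ends a₃ (↑W : Set V) ∩ PDEvent ends a₁ a₂ a₃ = ∅ := by
  ext ω
  simp only [Set.mem_inter_iff, mem_clusterEvent, mem_PDEvent_iff, Set.mem_empty_iff_false,
    iff_false, not_and]
  intro hS _ _ hn
  exact hn ((conn_iff_mem_of_cluster_eq hS a₂).2 (by simpa using h2))

omit [Fintype V] [DecidableEq V] in
/-- Mirror: with `a₁ ∈ W`, `PD = ∅`. -/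
lemma cl_PD_empty_of_mem₁ (ends : E → Sym2 V) (W : Finset V) (a₁ a₂ a₃ : V) (h1 : a₁ ∈ W) :
    clusterEvent ends a₃ (↑W : Set V) ∩ PDEvent ends a₁ a₂ a₃ = ∅ := by
  ext ω
  simp only [Set.mem_inter_iff, mem_clusterEvent, mem_PDEvent_iff, Set.mem_empty_iff_false,
    iff_false, not_and]
  intro hS _ hn _
  exact hn ((conn_iff_mem_of_cluster_eq hS a₁).2 (by simpa using h1))

end Worlds

end Summit.Ventures.PercRepro2

namespace Summit.Ventures.PercRepro2

/-! ## BHK and Harris in the residual graph `G ∖ W` -/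

section ResidualBHK

variable {V : Type*} {E : Type*} [Fintype E] [DecidableEq E] [Fintype V] [DecidableEq V]
  {R : Type*} [Field R] [LinearOrder R] [IsStrictOrderedRing R]

omit [Fintype E] [DecidableEq E] [Fintype V] [DecidableEq V] in
/-- `{C(s) ∋ x}` is the connection event. -/
lemma clusterInEvent_mem_eq (ends : E → Sym2 V) (s x : V) :
    clusterInEvent ends s {S | x ∈ S} = connEvent ends s x := by
  ext ω; simp [clusterInEvent, cluster]

omit [Fintype E] [DecidableEq E] in
/-- `delQ` as a `restrict`-preimage. -/
lemma delQ_eq_preimage (ends : E → Sym2 V) (W : Finset V) (a₁ a₂ : V) :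
    delQ ends W a₁ a₂ = {ω | restrict (touches ends ↑W)ᶜ ω ∈ (connEvent ends a₁ a₂)ᶜ} := by
  ext ω; simp [delQ]

omit [Fintype E] [DecidableEq E] in
/-- Intersections of `restrict`-preimages are preimages of intersections. -/
lemma preimage_inter_eq (ends : E → Sym2 V) (W : Finset V) (A B : Set (Config E)) :
    {ω | restrict (touches ends ↑W)ᶜ ω ∈ A} ∩ {ω | restrict (touches ends ↑W)ᶜ ω ∈ B} =
      {ω | restrict (touches ends ↑W)ᶜ ω ∈ A ∩ B} := by
  ext ω; simp

omit [Fintype V] [DecidableEq V] in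
/-- `a ≤ c / q` from `a · q ≤ c` when `0 ≤ a ≤ q` (the case `q = 0` forces `a = 0`). -/
lemma le_div_of_mul_le_of_le {a c q : R} (ha : 0 ≤ a) (haq : a ≤ q) (h : a * q ≤ c) :
    a ≤ c / q := by
  rcases (ha.trans haq).lt_or_eq with hq | hq
  · exact (le_div_iff₀ hq).2 h
  · rw [← hq, div_zero]
    exact le_antisymm (haq.trans hq.symm.le) ha |>.le

/-- **Cross-cluster BHK in the residual graph**: for `s, t ∉ W`,
`P_W(s ↮ t, s ↔ u, t ↔ w) · P_W(s ↮ t) ≤ P_W(s ↮ t, s ↔ u) · P_W(s ↮ t, t ↔ w)`, every probability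
read in `G ∖ W` (`delQ`, `connDelEvent`). -/
theorem bhk_cross_del (p : E → R) (hp : IsProbVec p) (ends : E → Sym2 V) (W : Finset V)
    (s t u w : V) :
    prob p (delQ ends W s t ∩ connDelEvent ends W s u ∩ connDelEvent ends W t w) *
        prob p (delQ ends W s t) ≤
      prob p (delQ ends W s t ∩ connDelEvent ends W s u) *
        prob p (delQ ends W s t ∩ connDelEvent ends W t w) := by
  classical
  have key := bhk_cross_cluster (zeroOn p (touches ends ↑W)) (isProbVec_zeroOn hp _) ends s t
    (𝓤 := {S | u ∈ S}) (𝓥 := {S | w ∈ S}) (fun _ _ h hx => h hx) (fun _ _ h hx => h hx)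
  rw [clusterInEvent_mem_eq, clusterInEvent_mem_eq] at key
  -- rewrite every residual probability as a zeroed-weight probability
  have e1 : prob p (delQ ends W s t ∩ connDelEvent ends W s u ∩ connDelEvent ends W t w) =
      prob (zeroOn p (touches ends ↑W))
        (connEvent ends s u ∩ connEvent ends t w ∩ (connEvent ends s t)ᶜ) := by
    rw [delQ_eq_preimage, connDelEvent_eq_preimage, connDelEvent_eq_preimage, preimage_inter_eq,
      preimage_inter_eq, prob_restrict_eq]
    congr 1
    ext ω; simp only [Set.mem_inter_iff, Set.mem_compl_iff]; tauto
  have e2 : prob p (delQ ends W s t) = prob (zeroOn p (touches ends ↑W)) (connEvent ends s t)ᶜ := by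
    rw [delQ_eq_preimage, prob_restrict_eq]
  have e3 : prob p (delQ ends W s t ∩ connDelEvent ends W s u) =
      prob (zeroOn p (touches ends ↑W)) (connEvent ends s u ∩ (connEvent ends s t)ᶜ) := by
    rw [delQ_eq_preimage, connDelEvent_eq_preimage, preimage_inter_eq, prob_restrict_eq]
    congr 1
    ext ω; simp only [Set.mem_inter_iff, Set.mem_compl_iff]; tauto
  have e4 : prob p (delQ ends W s t ∩ connDelEvent ends W t w) =
      prob (zeroOn p (touches ends ↑W)) (connEvent ends t w ∩ (connEvent ends s t)ᶜ) := by
    rw [delQ_eq_preimage, connDelEvent_eq_preimage, preimage_inter_eq, prob_restrict_eq]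
    congr 1
    ext ω; simp only [Set.mem_inter_iff, Set.mem_compl_iff]; tauto
  rw [e1, e2, e3, e4]
  exact key

/-- **Harris in the residual graph**: `P_W(x ↔ u) · P_W(x ↔ w) ≤ P_W(x ↔ u, x ↔ w)`. -/
theorem harris_del (p : E → R) (hp : IsProbVec p) (ends : E → Sym2 V) (W : Finset V) (x u w : V) :
    prob p (connDelEvent ends W x u) * prob p (connDelEvent ends W x w) ≤
      prob p (connDelEvent ends W x u ∩ connDelEvent ends W x w) := by
  classical
  rw [prob_connDelEvent, prob_connDelEvent, connDelEvent_eq_preimage, connDelEvent_eq_preimage,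
    preimage_inter_eq, prob_restrict_eq]
  exact prob_mul_prob_le_prob_inter (isProbVec_zeroOn hp _) (isUpperSet_connEvent ends x u)
    (isUpperSet_connEvent ends x w)

end ResidualBHK

end Summit.Ventures.PercRepro2
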